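import Literature.AlgebraicGeometry.HodgeTheory.DirectImageEndomorphism
import Literature.AlgebraicGeometry.HodgeTheory.PolarizationFormMonodromyInvariant
import Literature.AlgebraicGeometry.HodgeTheory.QbarFamilyLocalSystem
import Literature.AlgebraicGeometry.HodgeTheory.FlatSectionNonvanishing
import Literature.AlgebraicGeometry.HodgeTheory.TopDegreeClasses
import Literature.AlgebraicGeometry.HodgeTheory.IsoTransport
import Literature.AlgebraicGeometry.VanGeemen1994.WeilDiscriminantClass
import Literature.AlgebraicGeometry.Motives.MotivatedCyclesAbelianPencilPieces
import Literature.AlgebraicGeometry.Motives.VarietiesProperProofs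
import HarnessLib

/-!
# Ring 2 · sub-cell AbelianAll (ALL ABELIAN VARIETIES), André axis, part L-a — THE DISCRIMINANT CLASS IS CONSTANT ALONG
# A PENCIL WITH A `K`-ACTION: van Geemen's `det H ∈ ℚˣ/Nm(Kˣ)` of the members `(X_s, φ_s, h_s)` of a compact abelian pencil
# carrying a global endomorphism `Φ` (restricting to `φ_s`) and a global class `H` (restricting to `h_s`) does not depend on
# `s` — parallel transport in the local systems `R¹f_*ℂ`, `R^{4n}f_*ℂ` on the tree's carriers (the binder «isodiscriminantal»
# of part XLIX-b DISCHARGED; owed item (o151) of RING2-MAP §AbelianAll answered in the affirmative)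

HONEST FRAMING (page 1, verbatim): **research route, not a corollary; conditional on HC_CM plus one named
minimal statement.** Cell line: research route conditional on HC_CM; not a corollary; Q11.4-sentence-2
already refuted in dim ≥ 3. Nothing in this file proves a case of the Hodge conjecture or of `B(X)` for a named `X`; nothing here
is Hodge-theoretic: the discriminant class of a Weil-type triple is a TOPOLOGICAL invariant of `(H¹(X; ℚ), φ^*, Q_h)` and this
file proves it is locally — hence, the base being connected, globally — constant in a family. `HC_CM`, `HC_AV`, the global
nodes, Verdier's binder: ABSENT. Item `Theses.RankFourFaces.CMToAbelian` (stmt-16267) stays OPEN; N104 untouched; no node is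
born (0 `def`, 0 `sorry`, no named fact). Seat `pub-hodge-ring2-ab-andre-2`, gen 42 (part L).

## Content (theorems only; standard axioms)

* §1 (AV level, pure algebra) **`hasWeilDiscriminantNondeg_of_transport`** — `HasWeilDiscriminantNondeg A φ n d h_A δ` is carried to
  `HasWeilDiscriminantNondeg B ψ n d h_B δ` by ANY pair of injective `ℂ`-linear maps `T₁ : H¹(A) → H¹(B)`, `T₂ : H^{4n}(A) → H^{4n}(B)`
  (degree `2 + 2(2n-1)`) preserving rational classes, intertwining `φ^*` with `ψ^*`, and carrying the polarization pairing
  `Q_{h_A, 2n-1}` to `Q_{h_B, 2n-1}` (the `K`-basis, the top class and the Gram matrices `a`, `b`, `q` are transported verbatim).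
* §2 (local systems) **`transportFun_lefschetzPow`**, **`transportFun_polarizationPairingOne`** — parallel transport in `R^•f_*ℂ` over a
  cohomologically locally trivial `U` (the tree's `transportFun`, `DirectImageTransport`) commutes with the iterated Lefschetz
  operator of a GLOBAL class and with the degree-one polarization pairing `Q_{H|X_s, j}(x, y) = (H|X_s)^j ⌣ x ⌣ y` (it is
  multiplicative, `transportFun_cupProduct`, and restrictions of global classes are flat, `transportFun_map_fiberι`).
* §3 **`hasWeilDiscriminantNondeg_of_fibreTransport`** — for a smooth proper family `π : 𝒳 ⟶ S` over a smooth connected compact base,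
  a global endomorphism `Φ` OVER `S` with fibre maps `Φ_s`, a global class `H ∈ H²(𝒳(ℂ); ℂ)`, and charts `e_s : A_s ≅ X_s` by abelian
  varieties with `e_s ∘ φ_s = Φ_s ∘ e_s`: **`det H` of `(A_s, φ_s, e_s^* j_s^* H)` is the same class `δ` at every `s`** — transport
  along a path from `s` to `t` (Ehresmann on complex points: `isCohomologicallyLocallyTrivialOn_univ`; `S(ℂ)` is a connected
  manifold, hence path connected) is injective (`transportFun_injective`), preserves rational classes
  (`IsHomotopicallyLocallyTrivialOn.isRationalClass_transportFun`), commutes with `Φ` (`transportFun_map_fiberHom`) and with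
  `Q_{H|X_s}` (§2); conjugate by the charts (`IsoTransport`). **`hasWeilDiscriminantNondeg_member_iff`** — the same for a compact
  abelian pencil `IsCompactAbelianPencil f d`, as an `iff` between any two members.

## Honest status

This is the print sentence "the discriminant `det H ∈ ℚˣ/Nm(Kˣ)` is locally constant in a family of polarized abelian varieties with
`K`-action" (van Geemen 4.14, Lemma 5.2 (3): an invariant of the `K`-Hermitian lattice, which is a local system) on the carriers. It
DISCHARGES the binder «isodiscriminantal» of part XLIX-b (`…TwistedProductLadder`, hypothesis `hIso`) in favour of STRUCTURE that
every Weil-type pencil has in print by definition — a global `K`-action `Φ` on `𝒳/S` compatible with the member charts and a global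
hyperplane class — see part L-b (`…AndreIsodiscriminantalRows`). It reverses the gen-41 assessment (o151) «NO on the present carriers
(needs H¹ transport)»: the `H¹` transport IS in the tree (`DirectImageTransport`, `DirectImageEndomorphism`, Ehresmann on complex
points). What stays Hodge-theoretic and displayed: Weil TYPE `(n, n)` of the members (the `K`-action on `H^{1,0}`), Verdier.
Strength of the open instance unchanged; nothing minimal is claimed; N104 untouched. EDGE LABELS: §1–§3 K (fact-free).
References: vanGeemen1994HodgeAV (4.14, Lemma 5.2 (2)–(3)); VoisinHodgeI2002 (Thm. 9.3, §9.2.1); VoisinHodgeII2003 (§3.1.2);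
Deligne1982HodgeCycles (proof of Thm. 4.8, pp. 56–61); Lange2023AbelianVarietiesComplex (§1.7.2 Lemma 1.7.4).
-/

noncomputable section

set_option linter.dupNamespace false

namespace Summit.HodgeConjecture.HodgeConjecture.Ring2.AbelianAll

open CategoryTheory AlgebraicGeometry
open _root_.Topology _root_.Filter
open Literature.AlgebraicGeometry Literature.AlgebraicGeometry.Motives
open Literature.AlgebraicGeometry.HodgeTheory Literature.AlgebraicGeometry.VanGeemen1994
open Literature.AlgebraicTopology.SingularHomology (singularCohomology cupProduct cupProduct_map)
open Literature.Geometry.Kaehler (lefschetzOperator lefschetzPow lefschetzPow_succ)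

/-! ## §1 AV level: the discriminant witness is transported by any `φ`-equivariant, `Q`-compatible pair of injective rational maps -/

section AVLevel

variable {A B : AbelianVariety ℂ} {φ : A ⟶ A} {ψ : B ⟶ B} {n d : ℕ}
  {hA : complexBetti A.X 2} {hB : complexBetti B.X 2}

/-- **Transport of `det H`.** Let `T₁ : H¹(A(ℂ); ℂ) → H¹(B(ℂ); ℂ)` and `T₂ : H^{2+2(2n-1)}(A(ℂ); ℂ) → H^{2+2(2n-1)}(B(ℂ); ℂ)` be
injective `ℂ`-linear maps carrying rational classes to rational classes, with `T₁ ∘ φ^* = ψ^* ∘ T₁` and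
`T₂ (Q_{h_A, 2n-1}(x, y)) = Q_{h_B, 2n-1}(T₁ x, T₁ y)`. Then a non-degenerate discriminant witness of class `δ` for `(A, φ, h_A)`
is carried to one for `(B, ψ, h_B)`: the `K`-basis `xᵢ ↦ T₁ xᵢ`, the top class `ω ↦ T₂ ω`, and the SAME rational Gram data
`a, b, q` (van Geemen Lemma 5.2 (3): `det Ψ` only sees the `K`-Hermitian lattice). [cite: vanGeemen1994HodgeAV, Lemma 5.2 (2)–(3) and 4.14] -/
theorem hasWeilDiscriminantNondeg_of_transport
    (T₁ : complexBetti A.X 1 →ₗ[ℂ] complexBetti B.X 1)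
    (T₂ : complexBetti A.X (2 + 2 * (2 * n - 1)) →ₗ[ℂ] complexBetti B.X (2 + 2 * (2 * n - 1)))
    (hT₁ : Function.Injective T₁) (hT₂ : Function.Injective T₂)
    (hr₁ : ∀ x, IsRationalClass x → IsRationalClass (T₁ x))
    (hr₂ : ∀ ω, IsRationalClass ω → IsRationalClass (T₂ ω))
    (hTφ : ∀ x, T₁ (complexBetti.map φ.hom.hom.hom 1 x) = complexBetti.map ψ.hom.hom.hom 1 (T₁ x))
    (hTQ : ∀ x y, T₂ (polarizationPairingOne A.X hA (2 * n - 1) x y) =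
      polarizationPairingOne B.X hB (2 * n - 1) (T₁ x) (T₁ y))
    {δ : weilNormResidueGroup d} (h : HasWeilDiscriminantNondeg A φ n d hA δ) :
    HasWeilDiscriminantNondeg B ψ n d hB δ := by
  obtain ⟨x, ω, a, b, q, hx, hind, hω, hω0, hQ, hdet, hq⟩ := h
  refine ⟨fun i => T₁ (x i), T₂ ω, a, b, q, fun i => hr₁ _ (hx i), ?_, hr₂ _ hω, ?_, fun i j => ?_, hdet, hq⟩
  · have hcomp : Sum.elim (fun i => T₁ (x i)) (fun i => complexBetti.map ψ.hom.hom.hom 1 (T₁ (x i))) =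
        T₁ ∘ Sum.elim x (fun i => complexBetti.map φ.hom.hom.hom 1 (x i)) := by
      funext i
      rcases i with i | i
      · rfl
      · simp only [Sum.elim_inr, Function.comp_apply, hTφ]
    rw [hcomp]
    exact hind.map' T₁ (LinearMap.ker_eq_bot.2 hT₁)
  · exact (map_ne_zero_iff T₂ hT₂).2 hω0
  · obtain ⟨h1, h2⟩ := hQ i j
    refine ⟨?_, ?_⟩
    · rw [← hTφ, ← hTQ, h1, map_smul]
    · rw [← hTQ, h2, map_smul]

end AVLevel

/-! ## §2 Transport commutes with the iterated Lefschetz operator of a global class and with the polarization pairing -/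

section Transport

variable {𝒳 S : SchemeOver ℂ} (π : 𝒳 ⟶ S) {U : Set (ComplexPoints S)} (hU : IsCohomologicallyLocallyTrivialOn π U)

/-- **Transport commutes with `Lʲ` of a GLOBAL class** `K ∈ H²(𝒳(ℂ); ℂ)` (restrictions `K|_{X_s}`): `γ_* ∘ Lʲ_{K|X_s} = Lʲ_{K|X_t} ∘ γ_*`
(induction on `j` from the tree's `transportFun_lefschetzOperator`). [cite: VoisinHodgeII2003, §3.1.2] -/
theorem transportFun_lefschetzPow (K : complexBetti 𝒳 2) {s t : U} (γ : Path.Homotopic.Quotient s t) (j k : ℕ)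
    (x : complexBetti (fiberOver π s.1) k) :
    transportFun π (k + 2 * j) hU γ (lefschetzPow (complexBetti.map (fiberι π s.1) 2 K) j k x) =
      lefschetzPow (complexBetti.map (fiberι π t.1) 2 K) j k (transportFun π k hU γ x) := by
  induction j with
  | zero => rfl
  | succ j ih =>
    simp only [lefschetzPow_succ, LinearMap.comp_apply]
    rw [transportFun_lefschetzOperator, ih]

/-- **Transport carries the polarization pairing of a global class to itself**: for `K ∈ H²(𝒳(ℂ); ℂ)`,
`γ_* (Q_{K|X_s, j}(x, y)) = Q_{K|X_t, j}(γ_* x, γ_* y)` on `H¹` (`Q_{h,j}(x,y) = Lʲ_h (x ⌣ y)`; transport is multiplicative and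
commutes with `Lʲ`). The flatness of the Riemann form of a relative polarization. [cite: VoisinHodgeII2003, §3.1.2]
[cite: Lange2023AbelianVarietiesComplex, §1.7.2 Lemma 1.7.4] -/
theorem transportFun_polarizationPairingOne (K : complexBetti 𝒳 2) {s t : U} (γ : Path.Homotopic.Quotient s t) (j : ℕ)
    (x y : complexBetti (fiberOver π s.1) 1) :
    transportFun π (2 + 2 * j) hU γ (polarizationPairingOne (fiberOver π s.1) (complexBetti.map (fiberι π s.1) 2 K) j x y) =
      polarizationPairingOne (fiberOver π t.1) (complexBetti.map (fiberι π t.1) 2 K) j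
        (transportFun π 1 hU γ x) (transportFun π 1 hU γ y) := by
  rw [polarizationPairingOne_apply, polarizationPairingOne_apply, transportFun_lefschetzPow, transportFun_cupProduct]

end Transport

/-! ## §3 The discriminant class is constant along the family -/

section Family

variable {𝒳 S : SchemeOver ℂ}

/-- **Transport of `det H` along a path, through charts.** For `π : 𝒳 ⟶ S` homotopically locally trivial over `U ⊆ S(ℂ)` (small
tubes retract onto their fibres — Ehresmann), an endomorphism `Φ` of `𝒳` OVER `S` with fibre maps `Φ_u` (`Φ_u ≫ ι_u = ι_u ≫ Φ`), a
global class `H ∈ H²(𝒳(ℂ); ℂ)`, a homotopy class of paths `γ` from `s` to `t` in `U`, and charts `e_A : A ≅ X_s`, `e_B : B ≅ X_t` by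
abelian varieties with endomorphisms `φ`, `ψ` matching `Φ_s`, `Φ_t`: a non-degenerate discriminant witness of class `δ` for
`(A, φ, e_A^*(H|X_s))` yields one for `(B, ψ, e_B^*(H|X_t))` — §1 applied to `T = e_B^* ∘ γ_* ∘ (e_A⁻¹)^*` in degrees `1` and
`2 + 2(2n-1)`: injective (`transportFun_injective`), rational (`IsHomotopicallyLocallyTrivialOn.isRationalClass_transportFun`),
`Φ`-equivariant (`transportFun_map_fiberHom`), `Q_H`-compatible (§2). [cite: vanGeemen1994HodgeAV, 4.14 and Lemma 5.2 (3)]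
[cite: VoisinHodgeII2003, §3.1.2] [cite: Deligne1982HodgeCycles, proof of Thm. 4.8 (pp. 56–61)] -/
theorem hasWeilDiscriminantNondeg_of_transportFun (π : 𝒳 ⟶ S) {U : Set (ComplexPoints S)}
    (hH : IsHomotopicallyLocallyTrivialOn π U) (Φ : 𝒳 ⟶ 𝒳) (hΦ : Φ ≫ π = π)
    (Φf : ∀ u : ComplexPoints S, fiberOver π u ⟶ fiberOver π u) (hΦf : ∀ u, Φf u ≫ fiberι π u = fiberι π u ≫ Φ)
    (H : complexBetti 𝒳 2) {s t : U} (γ : Path.Homotopic.Quotient s t)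
    {A B : AbelianVariety ℂ} (eA : A.X ≅ fiberOver π s.1) (eB : B.X ≅ fiberOver π t.1) {φ : A ⟶ A} {ψ : B ⟶ B}
    (heA : eA.hom ≫ Φf s.1 = φ.hom.hom.hom ≫ eA.hom) (heB : eB.hom ≫ Φf t.1 = ψ.hom.hom.hom ≫ eB.hom)
    {n dK : ℕ} {δ : weilNormResidueGroup dK}
    (hs : HasWeilDiscriminantNondeg A φ n dK (complexBetti.map eA.hom 2 (complexBetti.map (fiberι π s.1) 2 H)) δ) :
    HasWeilDiscriminantNondeg B ψ n dK (complexBetti.map eB.hom 2 (complexBetti.map (fiberι π t.1) 2 H)) δ := by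
  have hU : IsCohomologicallyLocallyTrivialOn π U := hH.isCohomologicallyLocallyTrivialOn
  -- `φ`-equivariance through the charts
  have hinv : eA.inv ≫ φ.hom.hom.hom = Φf s.1 ≫ eA.inv := by
    rw [Iso.inv_comp_eq, ← Category.assoc, heA, Category.assoc, Iso.hom_inv_id, Category.comp_id]
  have h1 : ∀ z, complexBetti.map eA.inv 1 (complexBetti.map φ.hom.hom.hom 1 z) =
      complexBetti.map (Φf s.1) 1 (complexBetti.map eA.inv 1 z) := fun z => by
    have hc := congrArg (fun F => complexBetti.map F 1 z) hinv
    simpa only [complexBetti.map_comp, ModuleCat.comp_apply] using hc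
  have h2 : ∀ y, complexBetti.map eB.hom 1 (complexBetti.map (Φf t.1) 1 y) =
      complexBetti.map ψ.hom.hom.hom 1 (complexBetti.map eB.hom 1 y) := fun y => by
    have hc := congrArg (fun F => complexBetti.map F 1 y) heB
    simpa only [complexBetti.map_comp, ModuleCat.comp_apply] using hc
  -- §1 applied to `T = e_B^* ∘ γ_* ∘ (e_A⁻¹)^*` in degrees `1` and `2 + 2(2n-1)`; every verification is a rewrite on the goal
  refine hasWeilDiscriminantNondeg_of_transport
    ((complexBetti.map eB.hom 1).hom ∘ₗ transportLinear π 1 hU γ ∘ₗ (complexBetti.map eA.inv 1).hom)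
    ((complexBetti.map eB.hom (2 + 2 * (2 * n - 1))).hom ∘ₗ transportLinear π (2 + 2 * (2 * n - 1)) hU γ ∘ₗ
      (complexBetti.map eA.inv (2 + 2 * (2 * n - 1))).hom)
    ?_ ?_ ?_ ?_ ?_ ?_ hs
  · intro z z' hzz'
    simp only [LinearMap.comp_apply, transportLinear_apply] at hzz'
    exact (complexBetti.bijective_map_of_iso eA.symm 1).1
      (transportFun_injective π 1 hU γ ((complexBetti.bijective_map_of_iso eB 1).1 hzz'))
  · intro z z' hzz'
    simp only [LinearMap.comp_apply, transportLinear_apply] at hzz'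
    exact (complexBetti.bijective_map_of_iso eA.symm _).1
      (transportFun_injective π _ hU γ ((complexBetti.bijective_map_of_iso eB _).1 hzz'))
  · intro z hz
    simp only [LinearMap.comp_apply, transportLinear_apply]
    exact IsRationalClass.pullback _ (hH.isRationalClass_transportFun π 1 γ (IsRationalClass.pullback _ hz))
  · intro z hz
    simp only [LinearMap.comp_apply, transportLinear_apply]
    exact IsRationalClass.pullback _ (hH.isRationalClass_transportFun π _ γ (IsRationalClass.pullback _ hz))
  · intro z
    simp only [LinearMap.comp_apply, transportLinear_apply]
    rw [h1, transportFun_map_fiberHom π 1 hU Φ hΦ Φf hΦf γ, h2]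
  · intro z w
    simp only [LinearMap.comp_apply, transportLinear_apply]
    rw [map_polarizationPairingOne eA.inv, eA.complexBetti_map_inv_map_hom, transportFun_polarizationPairingOne π hU H γ,
      map_polarizationPairingOne eB.hom]

/-- **`det H` IS CONSTANT ALONG A SMOOTH PROPER FAMILY WITH A `K`-ACTION.** Let `π : 𝒳 ⟶ S` be proper and smooth over a separated
compact base `S`, smooth and of finite type over `ℂ` with `S(ℂ)` connected; `Φ : 𝒳 ⟶ 𝒳` an endomorphism OVER `S` (`Φ ≫ π = π`); `H` a
global class in `H²(𝒳(ℂ); ℂ)`; and for every `s` a chart `e_s : A_s ≅ X_s` by an abelian variety with an endomorphism `φ_s` such that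
`e_s ∘ φ_s = Φ_s ∘ e_s` for the fibre map `Φ_s` of `Φ` (`Φ_s ≫ ι_s = ι_s ≫ Φ`). If `(A_s, φ_s, e_s^* (H|X_s))` has a non-degenerate
discriminant witness of class `δ ∈ ℚˣ/Nm(K_dˣ)` for ONE `s`, then so has `(A_t, φ_t, e_t^* (H|X_t))` for EVERY `t`: join `s` to `t`
by a path (`S(ℂ)` is a connected manifold, hence path connected; Ehresmann on complex points makes `π(ℂ)` homotopically locally
trivial over all of `S(ℂ)`, `isHomotopicallyLocallyTrivialOn_univ`) and apply the previous theorem.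
[cite: vanGeemen1994HodgeAV, 4.14 and Lemma 5.2 (3)] [cite: VoisinHodgeI2002, Thm. 9.3 and §9.2.1]
[cite: Deligne1982HodgeCycles, proof of Thm. 4.8 (pp. 56–61)] -/
theorem hasWeilDiscriminantNondeg_of_fibreTransport (π : 𝒳 ⟶ S) (d m : ℕ)
    [SmoothOfRelativeDimension d π.left] [IsProper π.left] [SmoothOfRelativeDimension m S.hom]
    [LocallyOfFiniteType S.hom] [IsSeparated S.hom] [CompactSpace S.left] [ConnectedSpace (ComplexPoints S)]
    (Φ : 𝒳 ⟶ 𝒳) (hΦ : Φ ≫ π = π) (H : complexBetti 𝒳 2)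
    (A : ComplexPoints S → AbelianVariety ℂ) (e : ∀ s, (A s).X ≅ fiberOver π s) (φ : ∀ s, A s ⟶ A s)
    (hK : ∀ s, ∃ Φs : fiberOver π s ⟶ fiberOver π s, Φs ≫ fiberι π s = fiberι π s ≫ Φ ∧ (e s).hom ≫ Φs = (φ s).hom.hom.hom ≫ (e s).hom)
    {n dK : ℕ} {δ : weilNormResidueGroup dK} (s t : ComplexPoints S)
    (hs : HasWeilDiscriminantNondeg (A s) (φ s) n dK (complexBetti.map (e s).hom 2 (complexBetti.map (fiberι π s) 2 H)) δ) :
    HasWeilDiscriminantNondeg (A t) (φ t) n dK (complexBetti.map (e t).hom 2 (complexBetti.map (fiberι π t) 2 H)) δ := by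
  choose Φf hΦf he using hK
  haveI := pathConnectedSpace_complexPoints_of_smoothOfRelativeDimension S m
  have hcont : Continuous fun x : ComplexPoints S => (⟨x, Set.mem_univ x⟩ : (Set.univ : Set (ComplexPoints S))) :=
    continuous_id.subtype_mk _
  exact hasWeilDiscriminantNondeg_of_transportFun π (isHomotopicallyLocallyTrivialOn_univ π d m) Φ hΦ Φf hΦf H
    (s := ⟨s, Set.mem_univ s⟩) (t := ⟨t, Set.mem_univ t⟩) ⟦(PathConnectedSpace.somePath s t).map hcont⟧
    (e s) (e t) (he s) (he t) hs

/-- **THE DISCRIMINANT CLASS IS THE SAME FOR ALL MEMBERS OF A COMPACT ABELIAN PENCIL WITH A `K`-ACTION** (`IsCompactAbelianPencil f d`: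
smooth projective family over a smooth projective curve): with `Φ`, `H`, the charts `(A_s, e_s, φ_s)` as above, for any two members
`s`, `t`: `(A_s, φ_s, e_s^*(H|X_s))` has a non-degenerate witness of class `δ` iff `(A_t, φ_t, e_t^*(H|X_t))` has one. This is the
binder «isodiscriminantal» of part XLIX-b as a THEOREM. [cite: vanGeemen1994HodgeAV, 4.14 and Lemma 5.2 (3)]
[cite: VoisinHodgeI2002, Thm. 9.3 and §9.2.1] -/
theorem hasWeilDiscriminantNondeg_member_iff {f : 𝒳 ⟶ S} {d : ℕ} (hf : IsCompactAbelianPencil f d)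
    (Φ : 𝒳 ⟶ 𝒳) (hΦ : Φ ≫ f = f) (H : complexBetti 𝒳 2)
    (A : ComplexPoints S → AbelianVariety ℂ) (e : ∀ s, (A s).X ≅ fiberOver f s) (φ : ∀ s, A s ⟶ A s)
    (hK : ∀ s, ∃ Φs : fiberOver f s ⟶ fiberOver f s, Φs ≫ fiberι f s = fiberι f s ≫ Φ ∧ (e s).hom ≫ Φs = (φ s).hom.hom.hom ≫ (e s).hom)
    {n dK : ℕ} (δ : weilNormResidueGroup dK) (s t : ComplexPoints S) :
    HasWeilDiscriminantNondeg (A s) (φ s) n dK (complexBetti.map (e s).hom 2 (complexBetti.map (fiberι f s) 2 H)) δ ↔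
      HasWeilDiscriminantNondeg (A t) (φ t) n dK (complexBetti.map (e t).hom 2 (complexBetti.map (fiberι f t) 2 H)) δ := by
  haveI : IsProper S.hom := IsSmoothProjective.isProper_holds hf.isSmoothProjective_base
  haveI : CompactSpace S.left := QuasiCompact.compactSpace_of_compactSpace S.hom
  haveI := hf.isSmoothProjective_base.smoothOfRelativeDimension
  haveI : IsProper f.left := hf.isSmoothProjectiveFamily.isProper
  haveI := hf.isSmoothProjectiveFamily.smoothOfRelativeDimension
  haveI := connectedSpace_complexPoints hf.isSmoothProjective_base
  exact ⟨hasWeilDiscriminantNondeg_of_fibreTransport f d 1 Φ hΦ H A e φ hK s t,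
    hasWeilDiscriminantNondeg_of_fibreTransport f d 1 Φ hΦ H A e φ hK t s⟩

end Family

end Summit.HodgeConjecture.HodgeConjecture.Ring2.AbelianAll

end
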